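/-
Copyright: the b2b-balaban T⁴-continuum CRUX team, row NE7b leaf lineage `t4-ne7b-formalise-leaf-01` (gen 84). Project licence.
-/
import Literature.MathematicalPhysics.QuantumFieldTheory.Balaban1983to89.B9SectEKernel
import Summits.QuantumFields.BalabanUV.T4Continuum.Spine.NE7b.CoerciveFluctuationFloor

/-!
# THE SCHUR PAIR FROM LETTERS: for `S` symmetric and `γ`-coercive and `Q` with an EXACT right inverse `M` (`QM = 1`, `⟨Mλ, SMλ⟩ ≤ C‖λ‖²`),
# BOTH invertibility letters of the pair `(H, P) = (S⁻¹Qᵀ(QS⁻¹Qᵀ)⁻¹, (QS⁻¹Qᵀ)⁻¹)` are THEOREMS (`S` a unit; `QS⁻¹Qᵀ` coercive with `C⁻¹`,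
# hence a unit), the two identities `QH = 1`, `SH = QᵀP` of `B9SectEKernel` hold for the explicit pair, the constrained minimum and the
# ceiling `P ≤ C` follow BY NAME, and with `‖Qᵀλ‖² ≤ q‖λ‖²` also the floor `P ≥ γ∕q` (row NE7b, node U5c; the two DISPLAYED invertibility
# letters of `…CoerciveFluctuationFloor.hessian_lower_of_deltaK` discharged in shape; [folklore] Schur complement ∕ `QGQInverse` by name)

Cell `pub-balaban`, sub-cell `t4`, spine estimate NE7b (`T4WeightBudget.RelWeightBound`; the cell's OWN estimate — NOT PRINTED in
[Bałaban 1983–89], NOT PROVED).  Crux-route work under `Spine/NE7b/` by a row leaf (`t4-ne7b-formalise-leaf-01` gen 84) on the windowed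
convexity road (R-P1) under FREEZE (0)'s crux-prover clause; NOTHING of Bałaban's is named as a Lean object, valued or asserted; no
`T4Continuum/Support` leaf typed; no `def`; zero `sorry`.  Imports (hub oleans present): this road's `…CoerciveFluctuationFloor` (CFF, leaf-05 g151 — §6's consumer, v1.1) and the reader cell's
`….Balaban1983to89.B9SectEKernel` (r1;
`extension_energy`, `constrained_min`, `form_upper_of_test`, `gamma0_assembly`; transitively `QGQInverse.Coercive ∕ isUnit_of_coercive ∕
qgq_coercive_of_approx_right_inverse ∕ two_dot_sub_form_le_inv_form`, `B9Thm311.dot_sq_le`).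

WHY.  `B9SectEKernel` characterises the pair `(H₁, (QG₁Q*)⁻¹)` of [B9] (3.155)–(3.156) INVERSE-FREE by the two identities `QH = 1`, `SH = QᵀP`
(`hQH ∕ hSH`); its only consumer on this road, `…CoerciveFluctuationFloor.hessian_lower_of_deltaK` (leaf-05 g151), INHABITS them with the explicit
pair `H := G₁Q_bᵀ(Q_bG₁Q_bᵀ)⁻¹`, `P := (Q_bG₁Q_bᵀ)⁻¹` at the price of TWO DISPLAYED INVERTIBILITY LETTERS `hG : IsUnit (G₁⁻¹).det`,
`hM : IsUnit (Q_b G₁ Q_bᵀ).det` («THEOREMS from two invertibility letters»), and `…CurlFormEnergyDomination` ∕ `…SectECovarianceLetters` list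
«the `(H, P)` invertibility letters (CFF §5)» among what is NOT HERE.  In print both are consequences of letters the road already displays:
`G₁⁻¹ = K + aQ*Q` is POSITIVE (Thm 3.11∕3.12 — the road's floor `γ`) hence invertible, and the averaging operator has an exact right inverse
(`QQ* ∝ 1` for block averages; in general any `M` with `QM = 1` and finite energy), which makes `QG₁Q*` coercive (the tree's
`QGQInverse.qgq_coercive_of_approx_right_inverse` at `θ = 0`).  THIS FILE writes that out: from (`S` symmetric, `γ`-coercive, `γ > 0`) and
(`QM = 1`, `⟨Mλ, SMλ⟩ ≤ C‖λ‖²`, `C > 0`) both letters are theorems, the pair's identities hold, and `B9SectEKernel`'s variational statements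
apply BY NAME with NO invertibility letter; the same four numbers give the two-sided letters of `P` (`γ∕q ≤ P ≤ C` with `‖Qᵀλ‖² ≤ q‖λ‖²`).

WHAT IS PROVED ([folklore]; `S : Matrix n n ℝ`, `Q : Matrix m n ℝ`, `M : Matrix n m ℝ`; the pair written inline, no `def`):
* §1 `isUnit_det_of_coercive` (`Coercive S γ`, `γ > 0` ⊢ `IsUnit S.det` — CFF's `hG` shape), `form_nonneg_of_coercive`.
* §2 **`coercive_qsq_of_right_inverse`** (`S` symmetric `γ`-coercive, `QM = 1`, `⟨Mλ, SMλ⟩ ≤ C‖λ‖²` ⊢ `Coercive (QS⁻¹Qᵀ) C⁻¹` —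
  `qgq_coercive_of_approx_right_inverse` BY NAME at `θ = 0`), `energy_right_inverse_le` (`C := Γμ` from `S ≤ Γ`, `‖Mλ‖² ≤ μ‖λ‖²`),
  **`isUnit_det_qsq_of_right_inverse`** (⊢ `IsUnit (QS⁻¹Qᵀ).det` — CFF's `hM` shape).
* §3 **`schurPair_identities`** (the two invertibility letters ⊢ `Q(S⁻¹Qᵀ(QS⁻¹Qᵀ)⁻¹) = 1` and `S(S⁻¹Qᵀ(QS⁻¹Qᵀ)⁻¹) = Qᵀ(QS⁻¹Qᵀ)⁻¹` — the
  `hQH ∕ hSH` of `B9SectEKernel`, CFF §5's internal computation isolated), **`schurPair_of_letters`** (the same from the four numbers).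
* §4 THE END BY NAME: **`constrained_min_of_letters`** (`B9SectEKernel.constrained_min` at the constructed pair: `QA = B` ⊢ `⟨B, PB⟩ ≤ ⟨A, SA⟩`,
  no invertibility letter), **`form_P_le_of_letters`** (`⟨B, PB⟩ ≤ C‖B‖²` — `form_upper_of_test` with the test right inverse `M`),
  `form_inv_ge_of_form_le` (`N` symmetric invertible psd, `N ≤ β` ⊢ `N⁻¹ ≥ β⁻¹` — `two_dot_sub_form_le_inv_form` with the test vector `β⁻¹B`),
  `form_qsq_le` (`⟨λ, QS⁻¹Qᵀλ⟩ ≤ γ⁻¹q‖λ‖²` for `‖Qᵀλ‖² ≤ q‖λ‖²`), **`form_P_two_sided`** (`(γ⁻¹q)⁻¹‖B‖² ≤ ⟨B, PB⟩ ≤ C‖B‖²`).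
* §5 toy (kernel): `Fin 1`, `S = 2·1`, `Q = M = 1` — the constrained minimum closes from the letters `γ = C = 2`.
* §6 (v1.1, appended) THE JUNCTION BY IMPORT: **`hessian_lower_of_deltaK_of_letters`** — `…CoerciveFluctuationFloor.hessian_lower_of_deltaK` BY NAME
  with `hG ∕ hM` SUPPLIED by §1–§2 from (`G₁⁻¹` `γ_G`-coercive, `γ_G > 0`) and (`Q_bM = 1`, `⟨Mλ, G₁⁻¹Mλ⟩ ≤ C_M‖λ‖²`); all other binders verbatim.

NOT HERE (honest): WHICH `S, Q, M` print's step has — `S = G₁⁻¹ = K + aQ*Q` of (3.128) (the dictionary `B10Eq54QuadForm.G1inv`; CFF §5's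
instantiation), `Q = Q_k(U)` the covariant multiscale average and its right inverse (`QQ* = L^{−dk}·1`-type only at `U = 1`; for `U ≠ 1` the
approximate right inverse of r1-g3 `QGQ-inverse-proof.md` with `θ > 0` — `qgq_coercive_of_approx_right_inverse` covers it, this file states the
exact case only), the numbers `γ, Γ, μ, q` BY VALUE ((A3) ∕ (A1c), NC-NE7b-α UNRULED); the right inverse `M` of `Q_b` BY VALUE
(`Q_bQ_bᵀ ∝ 1` for print's block average — the dictionary's, not here; §6 takes `M` as a binder); the `J`-term and the admissible subspace (`gamma0_assembly`'s other inputs, untouched).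
BY-NAME EFFECT ON THE WALL: NONE (two displayed letters of the (ℓ1) socket become theorems of four displayed numbers; the wall is (R2)).
NE7b NOT PRINTED ∕ NOT PROVED; spine PROVED 0∕9; rung (B)+1 on a FINITE torus — NOT infinite volume, NOT the mass gap, NOT Clay.  HONEST
DEPENDENCY: continuum YM on T⁴ ⇐ BetaPertH ∧ nine spine estimates (0∕9 proved); BetaPertH ⇐ (D1) ∧ (D4) ∧ CAP+tail; G-an2-4 gates asym,
D1 and NE2∕3∕4.
-/

set_option autoImplicit false

open Matrix Finset

namespace Summit.QuantumFields.BalabanUV.T4Continuum.NE7b.SchurPairFromLetters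

open Literature.MathematicalPhysics.QuantumFieldTheory.Balaban1983to89
open Literature.MathematicalPhysics.QuantumFieldTheory.Balaban1983to89.QGQInverse (Coercive isUnit_of_coercive
  qgq_coercive_of_approx_right_inverse)
open Literature.MathematicalPhysics.QuantumFieldTheory.Balaban1983to89.B9SectEKernel (extension_energy constrained_min
  form_upper_of_test gamma0_assembly)

variable {n m : Type*} [Fintype n] [DecidableEq n] [Fintype m] [DecidableEq m]

/-! ## §1 The fine operator: a coercive matrix is a unit (the first invertibility letter) -/

/-- **THE FIRST INVERTIBILITY LETTER FROM COERCIVITY**: `S` `γ`-coercive with `γ > 0` ⊢ `IsUnit S.det` — verbatim the `hG`-shape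
letter of `…CoerciveFluctuationFloor.hessian_lower_of_deltaK` (`QGQInverse.isUnit_of_coercive` BY NAME + `Matrix.isUnit_iff_isUnit_det`). [folklore] -/
theorem isUnit_det_of_coercive {S : Matrix n n ℝ} {γ : ℝ} (hγ : 0 < γ) (hS : Coercive S γ) : IsUnit S.det :=
  (Matrix.isUnit_iff_isUnit_det S).mp (isUnit_of_coercive hγ hS)

omit [DecidableEq n] in
/-- A coercive matrix with `γ > 0` has a non-negative form. [folklore] -/
theorem form_nonneg_of_coercive {S : Matrix n n ℝ} {γ : ℝ} (hγ : 0 < γ) (hS : Coercive S γ) (v : n → ℝ) :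
    0 ≤ v ⬝ᵥ (S *ᵥ v) :=
  (mul_nonneg hγ.le (Literature.LinearAlgebra.Matrix.dotProduct_self_nonneg_real v)).trans (hS v)

/-! ## §2 The coarse operator `N = QS⁻¹Qᵀ` is coercive from an EXACT right inverse of `Q` (the second invertibility letter) -/

section Coarse

variable {S : Matrix n n ℝ} {Q : Matrix m n ℝ} {M : Matrix n m ℝ} {γ C : ℝ}

/-- **`QS⁻¹Qᵀ` IS COERCIVE FROM AN EXACT RIGHT INVERSE**: `S` symmetric and `γ`-coercive (`γ > 0`), `QM = 1`, and the energy letter of the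
right inverse `⟨Mλ, SMλ⟩ ≤ C‖λ‖²` (`C > 0`) ⊢ `Coercive (QS⁻¹Qᵀ) C⁻¹` — the tree's `QGQInverse.qgq_coercive_of_approx_right_inverse` BY NAME at
`θ = 0` with the test map `λ ↦ Mλ` (exact right inverse: `⟨QMλ, λ⟩ = ‖λ‖²`). [folklore] -/
theorem coercive_qsq_of_right_inverse (hsymm : S.IsSymm) (hγ : 0 < γ) (hS : Coercive S γ) (hQM : Q * M = 1) (hC : 0 < C)
    (hE : ∀ lam : m → ℝ, (M *ᵥ lam) ⬝ᵥ (S *ᵥ (M *ᵥ lam)) ≤ C * (lam ⬝ᵥ lam)) :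
    Coercive (Q * S⁻¹ * Qᵀ) C⁻¹ := by
  have h := qgq_coercive_of_approx_right_inverse S hsymm (isUnit_of_coercive hγ hS) (form_nonneg_of_coercive hγ hS) Q hC
    (θ := 0) (by norm_num) (fun lam => M *ᵥ lam)
    (fun lam => by rw [Matrix.mulVec_mulVec, hQM, Matrix.one_mulVec, sub_zero, one_mul]) hE
  simpa only [sub_zero, one_pow, one_div] using h

omit [DecidableEq n] [DecidableEq m] in
/-- The energy letter of the right inverse from two norms: `⟨v, Sv⟩ ≤ Γ‖v‖²` (`Γ ≥ 0`) and `‖Mλ‖² ≤ μ‖λ‖²` ⊢ `⟨Mλ, SMλ⟩ ≤ Γμ‖λ‖²`. [folklore] -/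
theorem energy_right_inverse_le {Γ μ : ℝ} (hΓ0 : 0 ≤ Γ) (hΓ : ∀ v : n → ℝ, v ⬝ᵥ (S *ᵥ v) ≤ Γ * (v ⬝ᵥ v))
    (hμ : ∀ lam : m → ℝ, (M *ᵥ lam) ⬝ᵥ (M *ᵥ lam) ≤ μ * (lam ⬝ᵥ lam)) (lam : m → ℝ) :
    (M *ᵥ lam) ⬝ᵥ (S *ᵥ (M *ᵥ lam)) ≤ Γ * μ * (lam ⬝ᵥ lam) :=
  (hΓ _).trans (by rw [mul_assoc]; exact mul_le_mul_of_nonneg_left (hμ lam) hΓ0)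

/-- **THE SECOND INVERTIBILITY LETTER**: under the same letters, `IsUnit (QS⁻¹Qᵀ).det` — verbatim the `hM`-shape letter of
`…CoerciveFluctuationFloor.hessian_lower_of_deltaK`. [folklore] -/
theorem isUnit_det_qsq_of_right_inverse (hsymm : S.IsSymm) (hγ : 0 < γ) (hS : Coercive S γ) (hQM : Q * M = 1) (hC : 0 < C)
    (hE : ∀ lam : m → ℝ, (M *ᵥ lam) ⬝ᵥ (S *ᵥ (M *ᵥ lam)) ≤ C * (lam ⬝ᵥ lam)) : IsUnit (Q * S⁻¹ * Qᵀ).det :=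
  isUnit_det_of_coercive (inv_pos.mpr hC) (coercive_qsq_of_right_inverse hsymm hγ hS hQM hC hE)

end Coarse

/-! ## §3 The Schur pair `(H, P) = (S⁻¹Qᵀ(QS⁻¹Qᵀ)⁻¹, (QS⁻¹Qᵀ)⁻¹)`: the two identities `QH = 1`, `SH = QᵀP` of `B9SectEKernel` -/

section Pair

variable {S : Matrix n n ℝ} {Q : Matrix m n ℝ}

/-- **THE TWO IDENTITIES OF THE PAIR FROM THE TWO INVERTIBILITY LETTERS**: `IsUnit S.det` and `IsUnit (QS⁻¹Qᵀ).det` ⊢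
`Q·(S⁻¹Qᵀ(QS⁻¹Qᵀ)⁻¹) = 1` and `S·(S⁻¹Qᵀ(QS⁻¹Qᵀ)⁻¹) = Qᵀ·(QS⁻¹Qᵀ)⁻¹` — the `hQH ∕ hSH` hypotheses of `B9SectEKernel.extension_energy ∕
constrained_min ∕ lower_transfer ∕ gamma0_assembly` (there characterising `(H₁, (QG₁Q*)⁻¹)` inverse-free), INHABITED by the explicit pair (the
computation inside `…CoerciveFluctuationFloor.hessian_lower_of_deltaK`, isolated). [folklore] -/
theorem schurPair_identities (hS : IsUnit S.det) (hN : IsUnit (Q * S⁻¹ * Qᵀ).det) :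
    Q * (S⁻¹ * Qᵀ * (Q * S⁻¹ * Qᵀ)⁻¹) = 1 ∧ S * (S⁻¹ * Qᵀ * (Q * S⁻¹ * Qᵀ)⁻¹) = Qᵀ * (Q * S⁻¹ * Qᵀ)⁻¹ := by
  constructor
  · rw [← Matrix.mul_assoc, ← Matrix.mul_assoc, Matrix.mul_nonsing_inv _ hN]
  · rw [← Matrix.mul_assoc, ← Matrix.mul_assoc, Matrix.mul_nonsing_inv _ hS, Matrix.one_mul]

variable {M : Matrix n m ℝ} {γ C : ℝ}

/-- **THE PAIR FROM LETTERS**: `S` symmetric `γ`-coercive (`γ > 0`), `QM = 1`, `⟨Mλ, SMλ⟩ ≤ C‖λ‖²` (`C > 0`) ⊢ both identities for the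
explicit pair — no invertibility letter displayed. [folklore] -/
theorem schurPair_of_letters (hsymm : S.IsSymm) (hγ : 0 < γ) (hS : Coercive S γ) (hQM : Q * M = 1) (hC : 0 < C)
    (hE : ∀ lam : m → ℝ, (M *ᵥ lam) ⬝ᵥ (S *ᵥ (M *ᵥ lam)) ≤ C * (lam ⬝ᵥ lam)) :
    Q * (S⁻¹ * Qᵀ * (Q * S⁻¹ * Qᵀ)⁻¹) = 1 ∧ S * (S⁻¹ * Qᵀ * (Q * S⁻¹ * Qᵀ)⁻¹) = Qᵀ * (Q * S⁻¹ * Qᵀ)⁻¹ :=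
  schurPair_identities (isUnit_det_of_coercive hγ hS) (isUnit_det_qsq_of_right_inverse hsymm hγ hS hQM hC hE)

end Pair

/-! ## §4 The END BY NAME: `B9SectEKernel`'s variational statements with the pair CONSTRUCTED, and the two-sided letters of `P` -/

section End

variable {S : Matrix n n ℝ} {Q : Matrix m n ℝ} {M : Matrix n m ℝ} {γ C : ℝ}

/-- **THE CONSTRAINED MINIMUM WITH NO INVERTIBILITY LETTER** ([B9] (3.155)–(3.156) ∕ (3.159) skeleton): under the letters of §3, for every
fine field `A` with `QA = B`, `⟨B, (QS⁻¹Qᵀ)⁻¹B⟩ ≤ ⟨A, SA⟩` — `B9SectEKernel.constrained_min` BY NAME at the constructed pair. [folklore] -/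
theorem constrained_min_of_letters (hsymm : S.IsSymm) (hγ : 0 < γ) (hS : Coercive S γ) (hQM : Q * M = 1) (hC : 0 < C)
    (hE : ∀ lam : m → ℝ, (M *ᵥ lam) ⬝ᵥ (S *ᵥ (M *ᵥ lam)) ≤ C * (lam ⬝ᵥ lam)) (A : n → ℝ) (B : m → ℝ) (hAB : Q *ᵥ A = B) :
    B ⬝ᵥ ((Q * S⁻¹ * Qᵀ)⁻¹ *ᵥ B) ≤ A ⬝ᵥ (S *ᵥ A) := by
  obtain ⟨hQH, hSH⟩ := schurPair_of_letters hsymm hγ hS hQM hC hE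
  exact constrained_min S hsymm (form_nonneg_of_coercive hγ hS) Q _ _ hQH hSH A B hAB

/-- **THE CEILING OF `P = (QS⁻¹Qᵀ)⁻¹` FROM THE RIGHT INVERSE**: `⟨B, PB⟩ ≤ C‖B‖²` — `B9SectEKernel.form_upper_of_test` BY NAME (the test
right inverse is `M` itself; the printed-nowhere `γ₁`-type ceiling, GAPS G-B10-06 (i), in letters). [folklore] -/
theorem form_P_le_of_letters (hsymm : S.IsSymm) (hγ : 0 < γ) (hS : Coercive S γ) (hQM : Q * M = 1) (hC : 0 < C)
    (hE : ∀ lam : m → ℝ, (M *ᵥ lam) ⬝ᵥ (S *ᵥ (M *ᵥ lam)) ≤ C * (lam ⬝ᵥ lam)) (B : m → ℝ) :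
    B ⬝ᵥ ((Q * S⁻¹ * Qᵀ)⁻¹ *ᵥ B) ≤ C * (B ⬝ᵥ B) := by
  obtain ⟨hQH, hSH⟩ := schurPair_of_letters hsymm hγ hS hQM hC hE
  exact form_upper_of_test S hsymm (form_nonneg_of_coercive hγ hS) Q _ _ hQH hSH M hQM hE B

/-- **THE FLOOR OF `P` FROM A CEILING OF `N = QS⁻¹Qᵀ`**: `N` symmetric with `⟨λ, Nλ⟩ ≤ β‖λ‖²` (`β > 0`) and `P = N⁻¹` (via `NP = 1`, read off
the letters) ⊢ `β⁻¹‖B‖² ≤ ⟨B, PB⟩` (Cauchy–Schwarz on `⟨B, B⟩ = ⟨NPB, B⟩`… in the form: test `A := PB` in `2⟨A, B⟩ − ⟨A, NA⟩ ≤ ⟨B, N⁻¹B⟩` —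
`QGQInverse.two_dot_sub_form_le_inv_form` BY NAME with the test vector `β⁻¹B`). [folklore] -/
theorem form_inv_ge_of_form_le {N : Matrix m m ℝ} (hNs : N.IsSymm) (hNu : IsUnit N) (hNpos : ∀ v : m → ℝ, 0 ≤ v ⬝ᵥ (N *ᵥ v))
    {β : ℝ} (hβ : 0 < β) (hNle : ∀ v : m → ℝ, v ⬝ᵥ (N *ᵥ v) ≤ β * (v ⬝ᵥ v)) (B : m → ℝ) :
    β⁻¹ * (B ⬝ᵥ B) ≤ B ⬝ᵥ (N⁻¹ *ᵥ B) := by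
  have h := QGQInverse.two_dot_sub_form_le_inv_form N hNs hNu hNpos (β⁻¹ • B) B
  have h1 : (β⁻¹ • B) ⬝ᵥ B = β⁻¹ * (B ⬝ᵥ B) := by rw [smul_dotProduct, smul_eq_mul]
  have h2 : (β⁻¹ • B) ⬝ᵥ (N *ᵥ (β⁻¹ • B)) ≤ β⁻¹ * (B ⬝ᵥ B) := by
    calc (β⁻¹ • B) ⬝ᵥ (N *ᵥ (β⁻¹ • B)) ≤ β * ((β⁻¹ • B) ⬝ᵥ (β⁻¹ • B)) := hNle _
      _ = β⁻¹ * (B ⬝ᵥ B) := by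
          rw [smul_dotProduct, dotProduct_smul, smul_eq_mul, smul_eq_mul]
          field_simp
  rw [h1] at h
  linarith

omit [DecidableEq m] in
/-- **THE CEILING OF `N = QS⁻¹Qᵀ` FROM THE FLOOR OF `S` AND THE NORM OF `Q`**: `⟨λ, QS⁻¹Qᵀλ⟩ = ⟨Qᵀλ, S⁻¹Qᵀλ⟩ ≤ γ⁻¹‖Qᵀλ‖² ≤ γ⁻¹q‖λ‖²`
for `‖Qᵀλ‖² ≤ q‖λ‖²` (no symmetry of `S` needed: `γ‖S⁻¹y‖² ≤ ⟨S⁻¹y, y⟩` and Cauchy–Schwarz). [folklore] -/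
theorem form_qsq_le (hγ : 0 < γ) (hS : Coercive S γ) {q : ℝ}
    (hQ : ∀ lam : m → ℝ, (Qᵀ *ᵥ lam) ⬝ᵥ (Qᵀ *ᵥ lam) ≤ q * (lam ⬝ᵥ lam)) (lam : m → ℝ) :
    lam ⬝ᵥ ((Q * S⁻¹ * Qᵀ) *ᵥ lam) ≤ γ⁻¹ * q * (lam ⬝ᵥ lam) := by
  set y : n → ℝ := Qᵀ *ᵥ lam with hy
  have hU : IsUnit S.det := isUnit_det_of_coercive hγ hS
  -- ⟨y, S⁻¹ y⟩ ≤ γ⁻¹ ‖y‖²: with x := S⁻¹ y, γ‖x‖² ≤ ⟨x, Sx⟩ = ⟨x, y⟩ ≤ ‖x‖‖y‖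
  set x : n → ℝ := S⁻¹ *ᵥ y with hx
  have hSx : S *ᵥ x = y := by rw [hx, Matrix.mulVec_mulVec, Matrix.mul_nonsing_inv S hU, Matrix.one_mulVec]
  have hc : γ * (x ⬝ᵥ x) ≤ x ⬝ᵥ y := by simpa [hSx] using hS x
  have hxx : 0 ≤ x ⬝ᵥ x := Literature.LinearAlgebra.Matrix.dotProduct_self_nonneg_real x
  have hyy : 0 ≤ y ⬝ᵥ y := Literature.LinearAlgebra.Matrix.dotProduct_self_nonneg_real y
  have hcs : (x ⬝ᵥ y) ^ 2 ≤ (x ⬝ᵥ x) * (y ⬝ᵥ y) := B9Thm311.dot_sq_le x y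
  have hxy0 : 0 ≤ x ⬝ᵥ y := (mul_nonneg hγ.le hxx).trans hc
  -- γ (x⬝y) ≤ γ ... : from γ (x⬝x) ≤ x⬝y get γ (x⬝y)² ≤ (x⬝y)(x⬝x)γ ≤ ... ; cleaner: γ (x ⬝ᵥ y) ≤ y ⬝ᵥ y
  have hkey : γ * (x ⬝ᵥ y) ≤ y ⬝ᵥ y := by
    -- (x⬝y)² ≤ (x⬝x)(y⬝y) ≤ γ⁻¹ (x⬝y) (y⬝y)  ⟹  (x⬝y) ≤ γ⁻¹ (y⬝y) when x⬝y > 0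
    rcases hxy0.eq_or_lt with h0 | hpos
    · rw [← h0, mul_zero]; exact hyy
    · have h1 : γ * (x ⬝ᵥ y) ^ 2 ≤ (x ⬝ᵥ y) * (y ⬝ᵥ y) := by
        calc γ * (x ⬝ᵥ y) ^ 2 ≤ γ * ((x ⬝ᵥ x) * (y ⬝ᵥ y)) := mul_le_mul_of_nonneg_left hcs hγ.le
          _ = (γ * (x ⬝ᵥ x)) * (y ⬝ᵥ y) := by ring
          _ ≤ (x ⬝ᵥ y) * (y ⬝ᵥ y) := mul_le_mul_of_nonneg_right hc hyy
      have h2 : γ * (x ⬝ᵥ y) * (x ⬝ᵥ y) ≤ (y ⬝ᵥ y) * (x ⬝ᵥ y) := by nlinarith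
      exact le_of_mul_le_mul_right h2 hpos
  have e : lam ⬝ᵥ ((Q * S⁻¹ * Qᵀ) *ᵥ lam) = x ⬝ᵥ y := by
    rw [← Matrix.mulVec_mulVec, ← Matrix.mulVec_mulVec, Matrix.dotProduct_mulVec lam Q, ← Matrix.mulVec_transpose, ← hy, ← hx,
      dotProduct_comm]
  rw [e]
  calc x ⬝ᵥ y ≤ γ⁻¹ * (y ⬝ᵥ y) := by
        rw [le_inv_mul_iff₀ hγ]; exact hkey
    _ ≤ γ⁻¹ * (q * (lam ⬝ᵥ lam)) := mul_le_mul_of_nonneg_left (hQ lam) (inv_nonneg.mpr hγ.le)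
    _ = γ⁻¹ * q * (lam ⬝ᵥ lam) := by ring

/-- **THE TWO-SIDED LETTERS OF `P = (QS⁻¹Qᵀ)⁻¹` FROM FOUR NUMBERS**: `S` symmetric, `γ`-coercive (`γ > 0`); `QM = 1` with the energy letter
`⟨Mλ, SMλ⟩ ≤ C‖λ‖²` (`C > 0`); `‖Qᵀλ‖² ≤ q‖λ‖²` (`q > 0`) ⊢ `(γ⁻¹q)⁻¹‖B‖² ≤ ⟨B, PB⟩ ≤ C‖B‖²` — the floor `γ∕q` and the ceiling `C` of the
coarse precision with NO invertibility letter. [folklore] -/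
theorem form_P_two_sided (hsymm : S.IsSymm) (hγ : 0 < γ) (hS : Coercive S γ) (hQM : Q * M = 1) (hC : 0 < C)
    (hE : ∀ lam : m → ℝ, (M *ᵥ lam) ⬝ᵥ (S *ᵥ (M *ᵥ lam)) ≤ C * (lam ⬝ᵥ lam)) {q : ℝ} (hq : 0 < q)
    (hQ : ∀ lam : m → ℝ, (Qᵀ *ᵥ lam) ⬝ᵥ (Qᵀ *ᵥ lam) ≤ q * (lam ⬝ᵥ lam)) (B : m → ℝ) :
    (γ⁻¹ * q)⁻¹ * (B ⬝ᵥ B) ≤ B ⬝ᵥ ((Q * S⁻¹ * Qᵀ)⁻¹ *ᵥ B) ∧ B ⬝ᵥ ((Q * S⁻¹ * Qᵀ)⁻¹ *ᵥ B) ≤ C * (B ⬝ᵥ B) := by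
  refine ⟨?_, form_P_le_of_letters hsymm hγ hS hQM hC hE B⟩
  have hNc : Coercive (Q * S⁻¹ * Qᵀ) C⁻¹ := coercive_qsq_of_right_inverse hsymm hγ hS hQM hC hE
  have hNs : (Q * S⁻¹ * Qᵀ).IsSymm := by
    have hSi : (S⁻¹).IsSymm := by
      unfold Matrix.IsSymm at hsymm ⊢
      rw [Matrix.transpose_nonsing_inv, hsymm]
    unfold Matrix.IsSymm
    rw [Matrix.transpose_mul, Matrix.transpose_mul, Matrix.transpose_transpose, hSi.eq, Matrix.mul_assoc]
  exact form_inv_ge_of_form_le hNs (isUnit_of_coercive (inv_pos.mpr hC) hNc) (form_nonneg_of_coercive (inv_pos.mpr hC) hNc)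
    (by positivity) (form_qsq_le hγ hS hQ) B

end End

/-! ## §5 Toy (kernel): `S = 2·1` on `Fin 1`, `Q = M = 1` — the pair is `(H, P) = (½·1·2, 2)`, the letters `γ = Γ = C = 2`, `q = 1` -/

/-- Toy: the constrained minimum on `Fin 1` with `S = 2`, `Q = 1`, right inverse `M = 1` (`⟨Mλ, SMλ⟩ = 2λ²`): `⟨B, PB⟩ ≤ ⟨A, SA⟩` whenever `A = B`. -/
example (A B : Fin 1 → ℝ) (hAB : (1 : Matrix (Fin 1) (Fin 1) ℝ) *ᵥ A = B) :
    B ⬝ᵥ (((1 : Matrix (Fin 1) (Fin 1) ℝ) * ((2 : ℝ) • (1 : Matrix (Fin 1) (Fin 1) ℝ))⁻¹ * (1 : Matrix (Fin 1) (Fin 1) ℝ)ᵀ)⁻¹ *ᵥ B)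
      ≤ A ⬝ᵥ (((2 : ℝ) • (1 : Matrix (Fin 1) (Fin 1) ℝ)) *ᵥ A) := by
  refine constrained_min_of_letters (S := (2 : ℝ) • (1 : Matrix (Fin 1) (Fin 1) ℝ)) (M := 1) (γ := 2) (C := 2) ?_ two_pos
    (fun v => ?_) (Matrix.mul_one _) two_pos (fun lam => ?_) A B hAB
  · unfold Matrix.IsSymm; rw [Matrix.transpose_smul, Matrix.transpose_one]
  · rw [Matrix.smul_mulVec, Matrix.one_mulVec, dotProduct_smul, smul_eq_mul]
  · rw [Matrix.one_mulVec, Matrix.smul_mulVec, Matrix.one_mulVec, dotProduct_smul, smul_eq_mul]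

/-! ## §6 (v1.1, appended) The junction with `…CoerciveFluctuationFloor.hessian_lower_of_deltaK` BY IMPORT: its two invertibility letters
`hG ∕ hM` DISCHARGED from the floor of `G₁⁻¹` and an exact right inverse of `Q_b` -/

section Junction

open Literature.MathematicalPhysics.QuantumFieldTheory.Balaban1983to89.B9Eq3152 (G1inv)
open Literature.MathematicalPhysics.QuantumFieldTheory.Balaban1983to89.B10Eq54QuadForm (delta1 deltaK G1inv_transpose)
open scoped RealInnerProductSpace

/-- **PRINT's `Δ_k` HESSIAN FLOOR WITH NO INVERTIBILITY LETTER** — `…CoerciveFluctuationFloor.hessian_lower_of_deltaK` (leaf-05 g151) BY NAME with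
its two displayed letters `hG : IsUnit (G₁⁻¹).det` and `hM : IsUnit (Q_bG₁Q_bᵀ).det` SUPPLIED by §1–§2 from: the FLOOR of print's fine operator
(`G₁⁻¹ = B9Eq3152.G1inv …` `γ_G`-coercive, `γ_G > 0` — Thm 3.11∕3.12's positivity as the road displays it) and an EXACT RIGHT INVERSE `M` of the
unit-lattice averaging `Q_b` (`Q_bM = 1`, energy `⟨Mλ, G₁⁻¹Mλ⟩ ≤ C‖λ‖²`, `C > 0`); every other binder ((h1), (h2), (hJ), the sandwich's `C ∕ good`,
`0 ≤ γ₀′`) VERBATIM CFF's.  `G₁⁻¹` symmetric is CFF's own `G1inv_transpose` from `K_b, C_b, Δ` symmetric. [folklore] -/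
theorem hessian_lower_of_deltaK_of_letters {N n₀ m₀ b₀ K : ℕ} (Kb Cb : Matrix (Fin b₀) (Fin b₀) ℝ) (hKb : Kbᵀ = Kb) (hCb : Cbᵀ = Cb)
    (Δs : Matrix (Fin n₀) (Fin n₀) ℝ) (hΔs : Δs.IsSymm) (Qs : Matrix (Fin m₀) (Fin n₀) ℝ) (a : ℝ)
    (D : Matrix (Fin b₀) (Fin n₀) ℝ) (Qb : Matrix (Fin K) (Fin b₀) ℝ) (ab : ℝ) (E : Matrix (Fin K) (Fin K) ℝ)
    {γG : ℝ} (hγG : 0 < γG) (hcoer : Coercive (G1inv Kb Cb Δs Qs a D Qb ab) γG)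
    (M : Matrix (Fin b₀) (Fin K) ℝ) (hQM : Qb * M = 1) {CM : ℝ} (hCM : 0 < CM)
    (hE : ∀ lam : Fin K → ℝ, (M *ᵥ lam) ⬝ᵥ (G1inv Kb Cb Δs Qs a D Qb ab *ᵥ (M *ᵥ lam)) ≤ CM * (lam ⬝ᵥ lam))
    (good : (Fin K → ℝ) → Prop) (Φ : (Fin K → ℝ) → ℝ) {κ₁ κ₂ c θ : ℝ} (hκ₁ : 0 < κ₁)
    (h1 : ∀ A : Fin b₀ → ℝ, Φ (Qb *ᵥ A) ≤
      κ₁ * (A ⬝ᵥ ((delta1 Kb Cb Δs Qs a D + D * Literature.MathematicalPhysics.QuantumFieldTheory.Balaban1983to89.B9H163.R Δs Qs a * Dᵀ) *ᵥ A))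
        + κ₂ * ((Qb *ᵥ A) ⬝ᵥ (Qb *ᵥ A)))
    (h2 : ∀ B : Fin K → ℝ, good B → c * (B ⬝ᵥ B) ≤ Φ B)
    (hJ : ∀ B : Fin K → ℝ, |B ⬝ᵥ ((E + Eᵀ) *ᵥ B)| ≤ θ * (B ⬝ᵥ B))
    (C : Matrix (Fin K) (Fin N) ℝ) (hgood : ∀ v : Fin N → ℝ, good (C *ᵥ v))
    (hC : ∀ v : Fin N → ℝ, v ⬝ᵥ v ≤ (C *ᵥ v) ⬝ᵥ (C *ᵥ v)) (hγ : 0 ≤ (c - κ₂) / κ₁ - θ) (x v : EuclideanSpace ℝ (Fin N)) :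
    2 * ((c - κ₂) / κ₁ - θ) * ‖v‖ ^ 2 ≤
      iteratedFDeriv ℝ 2 (fun z : EuclideanSpace ℝ (Fin N) =>
        ⟪z, Matrix.toEuclideanCLM (𝕜 := ℝ) (Cᵀ * deltaK Kb Cb Δs Qs a D Qb ab E * C) z⟫) x ![v, v] := by
  have hGs : (G1inv Kb Cb Δs Qs a D Qb ab).IsSymm := G1inv_transpose Kb Cb hKb hCb Δs Qs a hΔs D Qb ab
  exact CoerciveFluctuationFloor.hessian_lower_of_deltaK Kb Cb hKb hCb Δs hΔs Qs a D Qb ab E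
    (isUnit_det_of_coercive hγG hcoer) (isUnit_det_qsq_of_right_inverse hGs hγG hcoer hQM hCM hE)
    good Φ hκ₁ h1 h2 hJ C hgood hC hγ x v

end Junction

end Summit.QuantumFields.BalabanUV.T4Continuum.NE7b.SchurPairFromLetters
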